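import Summits.BirchSwinnertonDyer.BirchSwinnertonDyer.Theorems.TameQuarticManinParityOptimalTwistIsTwistOfOptimal
import Summits.BirchSwinnertonDyer.BirchSwinnertonDyer.Theorems.TameQuarticManinParityOptimalTwistNeronLatticeOfSplit
import Summits.BirchSwinnertonDyer.BirchSwinnertonDyer.Theorems.TameQuarticManinParityTwistNeronLatticeKodairaThree
import HarnessLib

/-!
# Route `TameQuarticManinParity`, LINE 25 (bsd-idea-3 g8), support T24L `TprimeIrrOptimalTwistNeronLattice`
# (stmt-BirchSwinnertonDyer-22694) — PROVED OUTRIGHT, by name: the OPTIMAL-TWIST NÉRON LATTICE IDENTITY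
# `z ∈ Λ(A) ↔ g(χ₋₃)·z ∈ Λ(W)` on the irreducible (t′) pairs at `3`

Cell `pub/bsd-wall`, D-0145 line `route-BirchSwinnertonDyer-TeichmullerTwistDescent`, seat `bsd-line-ttd-p1` g10.
BSD is NOT proved by this; Manin's conjecture is not proved by this.

## Proof

The glue GT24L (`tprimeIrrOptimalTwistNeronLatticeOfSplit_proof`) applied to α
(`tprimeIrrOptimalTwistIsTwistOfOptimal_proof`, LINE 25c, proved outright) and β (`twistNeronLatticeKodairaThree_proof`,
the `q = 3` instance of Stevens' Lemma (5.2) at `ord₃ Δ_min = 3 < 6`). Design: one composition; no definition, no named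
fact, no `sorry`; axioms `propext`, `Classical.choice`, `Quot.sound`.
-/

set_option autoImplicit false
-- D-0017: single-problem summit, so `Summit.BirchSwinnertonDyer.BirchSwinnertonDyer.…` repeats a namespace BY DESIGN.
set_option linter.dupNamespace false

namespace Summit.BirchSwinnertonDyer.BirchSwinnertonDyer.Theorems.TameQuarticManinParity

open Summit.BirchSwinnertonDyer.BirchSwinnertonDyer.Theses.TameQuarticManinParity

/-- **T24L `TprimeIrrOptimalTwistNeronLattice`** (stmt-BirchSwinnertonDyer-22694), OUTRIGHT: `Λ(A) = g(χ₋₃)⁻¹Λ(W)` for the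
optimal data of an irreducible (t′) twist pair (GT24L ∘ (α, β)). [cite: Stevens1989, Lemma (5.2) p. 96]
[cite: Pal2012, Prop. 2.5] -/
theorem tprimeIrrOptimalTwistNeronLattice_proof : TprimeIrrOptimalTwistNeronLattice :=
  tprimeIrrOptimalTwistNeronLatticeOfSplit_proof tprimeIrrOptimalTwistIsTwistOfOptimal_proof
    twistNeronLatticeKodairaThree_proof

end Summit.BirchSwinnertonDyer.BirchSwinnertonDyer.Theorems.TameQuarticManinParity
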